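import Summits.QuantumFields.BalabanUV.T4Continuum.Support.NE7HdecompOfDirectLetters
import Summits.QuantumFields.BalabanUV.T4Continuum.Support.NE7HintOfSliceNormalisationSU2DecSlice
import HarnessLib

/-!
# NE7HintOfDirectLettersSU2 — ROW NE7's END OF RECORD OVER THE TWO DIRECT LETTERS (memo ROAD-G102 §3–§4): gen 99's `NE7HintOfSliceNormalisationSU2DecSlice.hint_SU2_of_decomposition`
# (HINT(SU(2), d = 4, L = 2) ⇐ ONE k-free strict line ∧ the honest per-pair binder `hdecomp♭` over `𝒯_E`) with `hdecomp♭` DISCHARGED by gen 102's `NE7HdecompOfDirectLetters.hdecomp_of_directLetters`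
# ((S1) the slice representative = THEOREM; (S2) the two direct letters = the ONE displayed hypothesis `hDL`): **HINT ⇐ the k-free strict line with `α̂ = C_S·ε`, `ν̂(q₂, ε)`, `κ̂(q₁, ε)` ∧ `hDL(q₂, q₁)`**

Cell `pub-balaban`, rung (B)+1 sub-cell t4, lineage `b2b-balaban-t4-ne7-p1`, generation 102 (CRUX PROVER NE7 #1 = OWNER of BINDER row NE7).  Memo `t4/b2b-balaban-t4-ne7-p1-g102/ROAD-G102.md`.
WHAT ([folklore]; 0 def, 0 sorry).  **`hint_SU2_of_directLetters`** (statement displayed).  After this file the (A)-bill of row NE7 on the Bałaban-slice road is EXACTLY: (S2) = `hDL` — the direct letters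
(DL2) `dirSq φ(u⋆) (periodBox N) ≤ q₂²·‖X(u⋆)‖_w²` and (DL1) `dirL1 φ(u⋆) (periodBox N) ≤ q₁·‖X(u⋆)‖_w²` for the coarse datum of the slice representative, with k-free `q₂, q₁` small enough for the line —
nothing else (memo §4 records the plan and the numerics).
HONEST FRAMING (page 1): composition of landed theorems; `hDL` and the numeric line are HYPOTHESES asserted for nothing; nothing of Bałaban's asserted; NE7 NOT PROVED; spine 0∕9; finite T⁴ rung (B)+1 —
NOT infinite volume, NOT mass gap, NOT BetaPertH, NOT Clay.  Continuum YM on T⁴ ⇐ BetaPertH ∧ nine spine estimates (0/9 proved); BetaPertH ⇐ (D1) ∧ (D4) ∧ CAP+tail; G-an2-4 gates asym, D1 and NE2/3/4.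
-/

set_option autoImplicit false

open scoped BigOperators Matrix Matrix.Norms.L2Operator
open NormedSpace Finset Set

namespace Summit.QuantumFields.BalabanUV.T4Continuum.NE7HintOfDirectLettersSU2

open Literature.MathematicalPhysics.QuantumFieldTheory.Balaban1983to89
open B7Prop1Explicit B7Prop2Explicit MatrixLog
open T4AveragingDeficitWall (IsUnitaryCfg IsSkewDir SmallField vary curl curlSq dirSq dirL1)
open T4AveragingDeficitWallBoundary (IsPeriodicCfg periodBox)
open AveragingDeficitPeriodicCounting (IsPeriodicDir)
open AveragingDeficitMultiLevelPrep (LevelSmall tower TangentIter cavgIter)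
open MinimalActionLevels (perWin)
open MinimalActionSandwich (IsMinimiser admissible)
open MinimalActionRate (sfClass)
open NE3HessForm (dAction)
open NE3SlicePoincareBudgetLine (CPLine)
open NE3EnergyShapes (IsUnitarySite IsPeriodicSite)
open NE3EnergyWeightedShapes (energyNormW)
open NE3QbarIterCovLiftPrep (cruxC)
open NE3SmoothRightInverseW (rightInvW)
open NE3RightInverseSolveLetters (thetaLoc)
open NE3RightInverseL2Letter (l2C)
open NE3HatInvCurlLetters (curl2C curl1C)
open NE3LinearisedAverageSup (curvSum)
open BlockAverageVaryDisc (rho0)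
open NE7MeanZeroGaugeSliceW (energyBlockLandauW)
open NE7SliceIterationState (repLog cornerLog coarseDatum)
open NE7HdecompOfDirectLetters (hdecomp_of_directLetters)
open NE7HintOfSliceNormalisationSU2DecSlice (hint_SU2_of_decomposition)

noncomputable section

variable {n : Type} [Fintype n] [DecidableEq n]

/-- **ROW NE7's END OF RECORD OVER THE TWO DIRECT LETTERS** (SU(2)∕U(2): `card n = 2`; `d = 4`, `L = 2`): there are `ℓ ≥ 1`, a k-free `C_S > 0` and `ε₀ > 0` such that for `0 < ε ≤ ε₀` there is `β₀ > 0`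
with: for every `0 < β ≤ β₀`, `N ≥ 1`, `q₂ ≥ 0`, `q₁`, IF the k-free strict line holds with the ceilings `α̂ := C_S·ε`, `ν̂ := √(l2C 4 2∕(1 − θ_ℓε)² + curl2C 4 2∕(1 − θ_ℓε)²)·q₂`,
`κ̂ := ε·(curl1C 4 2∕(1 − θ_ℓε))·q₁` (`θ_ℓ = thetaLoc 4 2`), AND the two direct letters `hDL(q₂, q₁)` hold for the coarse datum of every slice representative (shape of
`NE7HdecompOfDirectLetters.hdecomp_of_directLetters`), THEN HINT: ∃ δV > 0 such that every unitary `N`-periodic `δV`-small datum `V` has, at every level `k`, a minimiser of the `(k, ε)`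
constrained problem that is STRICTLY small-field. [folklore] -/
theorem hint_SU2_of_directLetters [Nonempty n] (hn : Fintype.card n = 2) :
    ∃ ℓ : ℕ, 1 ≤ ℓ ∧ ∃ CS : ℝ, 0 < CS ∧ ∃ ε₀ : ℝ, 0 < ε₀ ∧ ∀ ε : ℝ, 0 < ε → ε ≤ ε₀ → ∃ β₀ : ℝ, 0 < β₀ ∧ ∀ β : ℝ, 0 < β → β ≤ β₀ →
    ∀ (N : ℕ) [NeZero N] (q₂ q₁ : ℝ), 1 ≤ N → 0 ≤ q₂ →
    -- ONE k-free strict line, at the ceilings `α̂ = C_S ε`, `ν̂(q₂, ε)`, `κ̂(q₁, ε)`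
    2 * (ε * (curl1C 4 2 / (1 - thetaLoc 4 2 * ε)) * q₁)
      < ((((1 / 2 - (Real.sqrt (l2C 4 2 / (1 - thetaLoc 4 2 * ε) ^ 2 + curl2C 4 2 / (1 - thetaLoc 4 2 * ε) ^ 2) * q₂) ^ 2) / (2 * (1 + (8 * CPLine 4 2 2 (1 / 10 ^ 17) (1 / 10 ^ 53) + 1)))
          - (Real.sqrt (l2C 4 2 / (1 - thetaLoc 4 2 * ε) ^ 2 + curl2C 4 2 / (1 - thetaLoc 4 2 * ε) ^ 2) * q₂) ^ 2) / 2
          - 576 * ((4 : ℕ) : ℝ) * ((CS * ε) ^ 2 * Real.exp (2 * (CS * ε)))) / (Fintype.card n : ℝ) - 28 * ((4 : ℕ) : ℝ) * (ε + 7 * (CS * ε) ^ 2)) →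
    -- (S2): THE TWO DIRECT LETTERS for the coarse datum of every slice representative
    (∀ (k : ℕ) (Us U' : Site 4 → Fin 4 → (Matrix n n ℂ)ˣ) (u : Site 4 → (Matrix n n ℂ)ˣ),
        IsUnitaryCfg Us → IsPeriodicCfg Us ((tower 2 N (k + 1) : ℕ) : ℤ) → SmallField Us (ε / (((2 : ℕ) : ℝ) ^ (k + 1)) ^ 2) →
        IsUnitaryCfg U' → IsPeriodicCfg U' ((tower 2 N (k + 1) : ℕ) : ℤ) → SmallField U' (ε / (((2 : ℕ) : ℝ) ^ (k + 1)) ^ 2) →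
        cavgIter 2 (k + 1) U' = cavgIter 2 (k + 1) Us →
        LevelSmall 4 2 k (ε / (((2 : ℕ) : ℝ) ^ (k + 1)) ^ 2) → LevelSmall 4 2 (k + 1) (ε / (((2 : ℕ) : ℝ) ^ (k + 1)) ^ 2) →
        cruxC 4 2 * ((((2 : ℕ) : ℝ) ^ (k + 1)) ^ 2 * (ε / (((2 : ℕ) : ℝ) ^ (k + 1)) ^ 2)) < 1 → curvSum 4 2 (k + 1) (ε / (((2 : ℕ) : ℝ) ^ (k + 1)) ^ 2) ≤ 2 / 3 * (2 : ℕ) →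
        4 * (3 + 12 * ((4 : ℕ) : ℝ)) ^ 2 * ((2 : ℕ) : ℝ) ^ (k + 1) * (CS * ε / ((2 : ℕ) : ℝ) ^ (k + 1)) ≤ rho0 4 2 ^ 2 →
        IsUnitarySite u → IsPeriodicSite u ((tower 2 N (k + 1) : ℕ) : ℤ) → gaugeAct u U' = vary Us (repLog Us U' u) 1 →
        (∀ (y : Site 4) (κ : Fin 4), ((2 : ℕ) : ℝ) ^ (k + 1) * ‖repLog Us U' u y κ‖ ≤ CS * ε) →
        (∀ z : Site 4, ((u ((((2 : ℕ) : ℤ)) ^ (k + 1) • z) : (Matrix n n ℂ)ˣ) : Matrix n n ℂ) = exp (cornerLog 2 k u z)) → (∀ z : Site 4, ‖cornerLog 2 k u z‖ ≤ CS * ε) →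
        (∀ (hWu' : IsUnitaryCfg Us) (hx' : 0 ≤ ε / (((2 : ℕ) : ℝ) ^ (k + 1)) ^ 2) (hs' : LevelSmall 4 2 k (ε / (((2 : ℕ) : ℝ) ^ (k + 1)) ^ 2))
            (hWx' : SmallField Us (ε / (((2 : ℕ) : ℝ) ^ (k + 1)) ^ 2)) (hθ' : cruxC 4 2 * ((((2 : ℕ) : ℝ) ^ (k + 1)) ^ 2 * (ε / (((2 : ℕ) : ℝ) ^ (k + 1)) ^ 2)) < 1)
            (hφ : IsSkewDir (coarseDatum 2 k Us U' u)),
          (fun y μ => repLog Us U' u y μ - rightInvW (le_refl 2) k hWu' hx' hs' hWx' N hθ' hφ y μ) ∈ energyBlockLandauW (d := 4) (n := n) 2 N (k + 1) Us) →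
        (((2 : ℕ) : ℝ) ^ (k + 1)) ^ 4 / (((2 : ℕ) : ℝ) ^ (k + 1)) ^ 4 * dirSq (coarseDatum 2 k Us U' u) (periodBox (d := 4) N)
            ≤ q₂ ^ 2 * energyNormW 2 (k + 1) Us (repLog Us U' u) (periodBox (d := 4) (N * 2 ^ (k + 1))) ^ 2 ∧
          (((2 : ℕ) : ℝ) ^ (k + 1)) ^ 4 / (((2 : ℕ) : ℝ) ^ (k + 1)) ^ 4 * dirL1 (coarseDatum 2 k Us U' u) (periodBox (d := 4) N)
            ≤ q₁ * energyNormW 2 (k + 1) Us (repLog Us U' u) (periodBox (d := 4) (N * 2 ^ (k + 1))) ^ 2) →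
    ∃ δV : ℝ, 0 < δV ∧
      ∀ V ∈ {V : Site 4 → Fin 4 → (Matrix n n ℂ)ˣ | IsUnitaryCfg V ∧ IsPeriodicCfg V (N : ℤ) ∧ SmallField V δV},
      ∀ k : ℕ, ∃ U : Site 4 → Fin 4 → (Matrix n n ℂ)ˣ, IsMinimiser 4 (sfClass 4 2 N ε) 2 N k V U ∧
        ∃ a : ℝ, 0 ≤ a ∧ a < ε / (((2 : ℕ) : ℝ) ^ k) ^ 2 ∧ SmallField U a := by
  obtain ⟨ℓ, hℓ, ε₀, hε₀, H⟩ := hint_SU2_of_decomposition (n := n) hn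
  obtain ⟨ε₂, hε₂, CS, hCS, HJ⟩ := hdecomp_of_directLetters (n := n)
  refine ⟨ℓ, hℓ, CS, hCS, min ε₀ ε₂, lt_min hε₀ hε₂, fun ε hε hεle => ?_⟩
  obtain ⟨β₀, hβ₀, H2⟩ := H ε hε (hεle.trans (min_le_left _ _))
  refine ⟨β₀, hβ₀, fun β hβ hβle N _ q₂ q₁ hN hq₂ hline hDL => ?_⟩
  exact H2 β hβ hβle N (CS * ε) _ _ hN hline (HJ N ε hε (hεle.trans (min_le_right _ _)) β q₂ q₁ hq₂ hDL)

end

end Summit.QuantumFields.BalabanUV.T4Continuum.NE7HintOfDirectLettersSU2
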